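import Literature.MathematicalPhysics.QuantumFieldTheory.Balaban1983to89.BlockAveragingEMLHaarAC

/-!
# FACT (A) of `BlockAveragingHaarAC` completed: the one-variable data at a coarse bond `c` — the open holonomies `V_i(U)`, the half-line transports
# `pre U c`, `post U c`, and the (0.4) guard at `U[β(c) ↦ g]` — are BLIND TO EVERY private coordinate `U(β(c′))`, hence to RESAMPLING all of them

Cell `pub-ymgap` (YM-PLAN Track A), width seat `pub-ymgap-dag-n09-w6` g3; helper of the K1 item of record (`--supports`, count-neutral).  Elementary lattice-walk
bookkeeping over pub-balaban's `BlockAveragingHaarAC` ∕ `BlockAveragingEMLHaarAC` ∕ `T4TriangularPushforward`, BY NAME; nothing of Bałaban's is asserted.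

WHY.  The private-coordinate fibred chart of the block averaging (`T4TriangularFibredChart.pi_restrict_preimage_inter_eq_map_prod_withDensity`, this seat) asks its
per-bond windows `Ω_c(U)` to be blind to the resampling of ALL private coordinates: `Ω_c(extend β g U) = Ω_c(U)` (`hΩbl`).  At the record the window is cut out by the
open holonomies `openHol U c i` (off-central `i`), the half-line transports `pre U c`, `post U c` and the (0.4) guard `Small ℰ (U[β(c) ↦ g]) c`
(`…N09CentralWindowInjective`).  `BlockAveragingHaarAC` proves FACT (A) in the forms «`Ū(c′)` ∕ the loop variables at `c′ ≠ c` ∕ `U(c′)` do not see `U(β(c))`»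
and «`V_i` (off-central), `pre`, `post` at `c` do not see `U(β(c))`».  THIS FILE adds the cross-bond forms for `V_i`, `pre`, `post` (from `openHol = loopHol·U(c)`
and the line-walk fact `eq_of_mem_walk_line_of_eq_centralBond`), the guard, and the passage from «blind to every single private update» to «blind to `extend β g`»
(finitely many updates).

CONTENTS (0 def, 0 sorry).  §1 generic: ★ `apply_extend_eq_of_forall_update` (a function of the configuration invariant under every private update is invariant under
resampling all private coordinates).  §2 one private coordinate at a time: `openHol_eq_loopHol_mul_axialAvg`, ★ `openHol_update_centralBond_of_ne`, `mem_walk_line_of_mem_walk_pre`,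
`mem_walk_line_of_mem_walk_post`, ★ `pre_update_centralBond_of_ne`, ★ `post_update_centralBond_of_ne`, `openHol_update_centralBond_any` (off-central `i`, any `c′`),
`pre_update_centralBond_any`, `post_update_centralBond_any`, ★ `small_update_update_centralBond_iff` (the guard at `U[β(c′) ↦ x][β(c) ↦ g]` is the guard at `U[β(c) ↦ g]`).
§3 all at once: ★★ `openHol_extend_centralBond`, `pre_extend_centralBond`, `post_extend_centralBond`, ★★ `small_update_extend_centralBond_iff`.

HONEST FRAMING.  Count-neutral lattice bookkeeping; no estimate; nothing printed asserted; N09 NOT discharged; K1 NOT closed; counts unmoved.  One finite four-torus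
programme at fixed `ε`; R4 closes the conditional rung `BalabanLadder.UV` only — not ℝ⁴ ∕ OS ∕ mass gap ∕ Clay.  No `sorry`, `axiom`, `def`, `instance`, `notation`.
-/

noncomputable section

open Function

namespace Literature.MathematicalPhysics.QuantumFieldTheory.Balaban1983to89.BlockAveragingCentralBlind

open T4Continuum AveragingRT BlockAveraging BlockAveragingHaarAC BlockAveragingEMLHaarAC
open T4ReflectionCone (holAt_congr)

/-! ## §1  Generic: blind to every private update ⟹ blind to resampling all private coordinates -/

section Generic

variable {ι κ G X : Type*} [DecidableEq ι]

/-- ★ If `Q(U)` does not change when ANY one private coordinate `U(β c)` is overwritten, then it does not change when ALL of them are resampled: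
`Q (extend β g U) = Q U` (`extend β g U` is `U` overwritten at each `β c` by `g c`; finitely many updates). [cite: Balaban1987RG1, (0.4) p.253 (bookkeeping)] -/
theorem apply_extend_eq_of_forall_update [Fintype κ] {β : κ → ι} (hβ : Injective β) {Q : (ι → G) → X}
    (hQ : ∀ (U : ι → G) (c : κ) (x : G), Q (update U (β c) x) = Q U) (U : ι → G) (g : κ → G) :
    Q (extend β g U) = Q U := by
  classical
  -- overwrite the private coordinates of a finite set `S` of coarse bonds
  have key : ∀ S : Finset κ, Q (fun i => if ∃ c ∈ S, β c = i then extend β g U i else U i) = Q U := by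
    intro S
    induction S using Finset.induction_on with
    | empty => congr 1
    | @insert c S hc ih =>
      have hstep : (fun i => if ∃ c' ∈ insert c S, β c' = i then extend β g U i else U i) =
          update (fun i => if ∃ c' ∈ S, β c' = i then extend β g U i else U i) (β c) (g c) := by
        funext i
        by_cases hi : i = β c
        · subst hi
          rw [update_self, if_pos ⟨c, Finset.mem_insert_self _ _, rfl⟩, hβ.extend_apply]
        · rw [update_of_ne hi]
          by_cases h' : ∃ c' ∈ S, β c' = i
          · obtain ⟨c', hc', rfl⟩ := h'
            rw [if_pos ⟨c', Finset.mem_insert_of_mem hc', rfl⟩, if_pos ⟨c', hc', rfl⟩]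
          · have h'' : ¬ ∃ c' ∈ insert c S, β c' = i := by
              rintro ⟨c', hc', rfl⟩
              rcases Finset.mem_insert.1 hc' with rfl | hc''
              · exact hi rfl
              · exact h' ⟨c', hc'', rfl⟩
            rw [if_neg h'', if_neg h']
      rw [hstep, hQ, ih]
  have hfull : (fun i => if ∃ c ∈ (Finset.univ : Finset κ), β c = i then extend β g U i else U i) = extend β g U := by
    funext i
    by_cases h : ∃ c, β c = i
    · obtain ⟨c, rfl⟩ := h
      rw [if_pos ⟨c, Finset.mem_univ _, rfl⟩]
    · rw [extend_apply' _ _ _ h]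
      split_ifs with h'
      · obtain ⟨c, -, hc⟩ := h'
        exact absurd ⟨c, hc⟩ h
      · rfl
  rw [← hfull]
  exact key Finset.univ

end Generic

/-! ## §2  One private coordinate at a time -/

section OneCoordinate

variable {P : Params} {j : ℕ} {G : Type*} [GaugeGroup G] [DecidableEq (PBond P j)]

omit [DecidableEq (PBond P j)] in
/-- `V_i = (loop variable)_i · U(c)` (`loopHol_eq_openHol_mul` read the other way). [cite: Balaban1987RG1, (0.4) p.253 (bookkeeping)] -/
theorem openHol_eq_loopHol_mul_axialAvg (U : GaugeField P j G) (c : PBond P (j+1)) (i : Idx P) :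
    openHol U c i = loopHol U c i * axialAvg U c := by
  rw [loopHol_eq_openHol_mul, inv_mul_cancel_right]

/-- ★ **The open holonomies at `c′` do not see `U(β(c))` for `c ≠ c′`** (every index `i`). [cite: Balaban1987RG1, (0.4) p.253 (bookkeeping)] -/
theorem openHol_update_centralBond_of_ne (hj : j + 1 ≤ P.m + P.K) (U : GaugeField P j G) (c c' : PBond P (j+1)) (hc : c' ≠ c)
    (g : G) (i : Idx P) : openHol (update U (centralBond c) g) c' i = openHol U c' i := by
  rw [openHol_eq_loopHol_mul_axialAvg, openHol_eq_loopHol_mul_axialAvg, loopHol_update_centralBond hj U c c' hc,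
    axialAvg_update_centralBond_of_ne hj U c c' hc]

omit [DecidableEq (PBond P j)] in
/-- The bonds of `pre`'s walk (first half of the line of `c`) are bonds of the line of `c`. [cite: Balaban1987RG1, (0.4) p.253 (bookkeeping)] -/
theorem mem_walk_line_of_mem_walk_pre (c : PBond P (j+1)) {s : LStep P j}
    (hs : s ∈ walk (emb c.src) (List.replicate ((P.L - 1) / 2) (c.dir, true))) :
    s ∈ walk (emb c.src) (List.replicate P.L (c.dir, true)) := by
  have hL := two_mul_half_add_one P
  have hsplit : List.replicate P.L ((c.dir, true) : Letter P.d) =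
      List.replicate ((P.L - 1) / 2) (c.dir, true) ++ List.replicate ((P.L - 1) / 2 + 1) (c.dir, true) := by
    rw [List.replicate_append_replicate]; congr 1; omega
  rw [hsplit, walk_append]
  exact List.mem_append_left _ hs

omit [DecidableEq (PBond P j)] in
/-- The bonds of `post`'s walk (second half of the line of `c`) are bonds of the line of `c`. [cite: Balaban1987RG1, (0.4) p.253 (bookkeeping)] -/
theorem mem_walk_line_of_mem_walk_post (c : PBond P (j+1)) {s : LStep P j}
    (hs : s ∈ walk (lineSite c ((P.L - 1) / 2 + 1)) (List.replicate ((P.L - 1) / 2) (c.dir, true))) :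
    s ∈ walk (emb c.src) (List.replicate P.L (c.dir, true)) := by
  have hL := two_mul_half_add_one P
  have hsplit : List.replicate P.L ((c.dir, true) : Letter P.d) =
      List.replicate ((P.L - 1) / 2 + 1) (c.dir, true) ++ List.replicate ((P.L - 1) / 2) (c.dir, true) := by
    rw [List.replicate_append_replicate]; congr 1; omega
  rw [hsplit, walk_append, walkEnd_replicate_line]
  exact List.mem_append_right _ hs

/-- ★ **`pre U c′` does not see `U(β(c))` for `c ≠ c′`** (the line of `c′` contains no central crossing bond but its own). [cite: Balaban1987RG1, (0.4) p.253 (bookkeeping)] -/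
theorem pre_update_centralBond_of_ne (hj : j + 1 ≤ P.m + P.K) (U : GaugeField P j G) (c c' : PBond P (j+1)) (hc : c' ≠ c) (g : G) :
    pre (update U (centralBond c) g) c' = pre U c' := by
  unfold pre
  refine holAt_congr fun s hs => update_of_ne ?_ _ _
  intro hsc
  exact hc (eq_of_mem_walk_line_of_eq_centralBond hj c' c (mem_walk_line_of_mem_walk_pre c' hs) hsc).symm

/-- ★ **`post U c′` does not see `U(β(c))` for `c ≠ c′`.** [cite: Balaban1987RG1, (0.4) p.253 (bookkeeping)] -/
theorem post_update_centralBond_of_ne (hj : j + 1 ≤ P.m + P.K) (U : GaugeField P j G) (c c' : PBond P (j+1)) (hc : c' ≠ c) (g : G) :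
    post (update U (centralBond c) g) c' = post U c' := by
  unfold post
  refine holAt_congr fun s hs => update_of_ne ?_ _ _
  intro hsc
  exact hc (eq_of_mem_walk_line_of_eq_centralBond hj c' c (mem_walk_line_of_mem_walk_post c' hs) hsc).symm

/-- At an OFF-CENTRAL index, `V_i` at `c` does not see ANY private coordinate `U(β(c′))` (`c′ = c`: `openHol_update_of_not_isCentral`; `c′ ≠ c`: the cross-bond form).
[cite: Balaban1987RG1, (0.4) p.253 (bookkeeping)] -/
theorem openHol_update_centralBond_any (hj : j + 1 ≤ P.m + P.K) (U : GaugeField P j G) (c c' : PBond P (j+1)) (i : Idx P) (hi : ¬ IsCentral c i)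
    (g : G) : openHol (update U (centralBond c') g) c i = openHol U c i := by
  by_cases hc : c = c'
  · subst hc; exact openHol_update_of_not_isCentral hj U c i hi g
  · exact openHol_update_centralBond_of_ne hj U c' c hc g i

/-- `pre U c` does not see ANY private coordinate. [cite: Balaban1987RG1, (0.4) p.253 (bookkeeping)] -/
theorem pre_update_centralBond_any (hj : j + 1 ≤ P.m + P.K) (U : GaugeField P j G) (c c' : PBond P (j+1)) (g : G) :
    pre (update U (centralBond c') g) c = pre U c := by
  by_cases hc : c = c'
  · subst hc; exact pre_update hj U c g
  · exact pre_update_centralBond_of_ne hj U c' c hc g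

/-- `post U c` does not see ANY private coordinate. [cite: Balaban1987RG1, (0.4) p.253 (bookkeeping)] -/
theorem post_update_centralBond_any (hj : j + 1 ≤ P.m + P.K) (U : GaugeField P j G) (c c' : PBond P (j+1)) (g : G) :
    post (update U (centralBond c') g) c = post U c := by
  by_cases hc : c = c'
  · subst hc; exact post_update hj U c g
  · exact post_update_centralBond_of_ne hj U c' c hc g

/-- ★ **THE (0.4) GUARD AT `U[β(c) ↦ g]` DOES NOT SEE ANY OTHER PRIVATE COORDINATE**: for every `c′` and `x`, the guard at `U[β(c′) ↦ x][β(c) ↦ g]`, bond `c`,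
is the guard at `U[β(c) ↦ g]` (the loop variables there are the W-coordinate family `fibreFamily U c (pre·g·post)`, built from `V_i` (off-central), `pre`, `post`).
[cite: Balaban1987RG1, (0.4) p.253 (bookkeeping)] -/
theorem small_update_update_centralBond_iff (hj : j + 1 ≤ P.m + P.K) (ℰ : LoopAverage G) (U : GaugeField P j G) (c c' : PBond P (j+1)) (x g : G) :
    Small ℰ (update (update U (centralBond c') x) (centralBond c) g) c ↔ Small ℰ (update U (centralBond c) g) c := by
  have hfam : fibreFamily (update U (centralBond c') x) c = fibreFamily U c := by
    funext W i
    by_cases hi : IsCentral c i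
    · rw [fibreFamily_of_isCentral _ c W i hi, fibreFamily_of_isCentral _ c W i hi]
    · rw [fibreFamily_of_not_isCentral _ c W i hi, fibreFamily_of_not_isCentral _ c W i hi, openHol_update_centralBond_any hj U c c' i hi]
  rw [small_update_centralBond_self_iff hj, small_update_centralBond_self_iff hj, pre_update_centralBond_any hj, post_update_centralBond_any hj]
  unfold FibreSmall
  rw [hfam]

end OneCoordinate

/-! ## §3  All private coordinates at once (resampling `extend β g U`) -/

section AllCoordinates

variable {P : Params} {j : ℕ} {G : Type*} [GaugeGroup G] [DecidableEq (PBond P j)]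

/-- ★★ At an off-central index, `V_i` at `c` is blind to resampling ALL private coordinates. [cite: Balaban1987RG1, (0.4) p.253 (bookkeeping)] -/
theorem openHol_extend_centralBond (hj : j + 1 ≤ P.m + P.K) (U : GaugeField P j G) (c : PBond P (j+1)) (i : Idx P) (hi : ¬ IsCentral c i)
    (g : PBond P (j+1) → G) : openHol (extend centralBond g U) c i = openHol U c i :=
  apply_extend_eq_of_forall_update (Q := fun V : GaugeField P j G => openHol V c i) (centralBond_injective hj)
    (fun V c' x => openHol_update_centralBond_any hj V c c' i hi x) U g

/-- `pre U c` is blind to resampling all private coordinates. [cite: Balaban1987RG1, (0.4) p.253 (bookkeeping)] -/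
theorem pre_extend_centralBond (hj : j + 1 ≤ P.m + P.K) (U : GaugeField P j G) (c : PBond P (j+1)) (g : PBond P (j+1) → G) :
    pre (extend centralBond g U) c = pre U c :=
  apply_extend_eq_of_forall_update (Q := fun V : GaugeField P j G => pre V c) (centralBond_injective hj)
    (fun V c' x => pre_update_centralBond_any hj V c c' x) U g

/-- `post U c` is blind to resampling all private coordinates. [cite: Balaban1987RG1, (0.4) p.253 (bookkeeping)] -/
theorem post_extend_centralBond (hj : j + 1 ≤ P.m + P.K) (U : GaugeField P j G) (c : PBond P (j+1)) (g : PBond P (j+1) → G) :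
    post (extend centralBond g U) c = post U c :=
  apply_extend_eq_of_forall_update (Q := fun V : GaugeField P j G => post V c) (centralBond_injective hj)
    (fun V c' x => post_update_centralBond_any hj V c c' x) U g

/-- ★★ **THE GUARD AT `U[β(c) ↦ g]` IS BLIND TO RESAMPLING ALL PRIVATE COORDINATES OF `U`.** [cite: Balaban1987RG1, (0.4) p.253 (bookkeeping)] -/
theorem small_update_extend_centralBond_iff (hj : j + 1 ≤ P.m + P.K) (ℰ : LoopAverage G) (U : GaugeField P j G) (c : PBond P (j+1))
    (g' : PBond P (j+1) → G) (g : G) :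
    Small ℰ (update (extend centralBond g' U) (centralBond c) g) c ↔ Small ℰ (update U (centralBond c) g) c := by
  have h := apply_extend_eq_of_forall_update (Q := fun V : GaugeField P j G => Small ℰ (update V (centralBond c) g) c)
    (centralBond_injective hj) (fun V c' x => propext (small_update_update_centralBond_iff hj ℰ V c c' x g)) U g'
  exact Iff.of_eq h

end AllCoordinates

end Literature.MathematicalPhysics.QuantumFieldTheory.Balaban1983to89.BlockAveragingCentralBlind

end
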